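/-
Copyright (c) 2026. All rights reserved.
Released under Apache 2.0 license as described in the file LICENSE.
Authors: abc-iut cell, prover seat abc-iut-L4-d1 (gen 8; row «HYP⇒NONAB@FINITE-TYPE», F2: the centraliser of a
translation in `PSL₂(ℝ)` and the bounded cusp function `e^{2πiτ/x}`).
-/
import Literature.AnabelianGeometry.AbsoluteAnabelian.ArchimedeanHolFieldFunctorGeometricPSLCuspCompare
import HarnessLib

/-!
# The centraliser of a parabolic element of `PSL₂(ℝ)` and the bounded cusp function (PROOF-ONLY)

Classical input for S. Mochizuki, *Topics in Absolute Anabelian Geometry III*, Cor. 2.4 p.54 / Prop. 4.2 (i)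
p.106, where the Riemann surfaces are «HYPERBOLIC Riemann surfaces of finite type», uniformised as `ℍ/Λ̄`:
the step «a hyperbolic surface of finite type has non-abelian `π₁`» (H. M. Farkas, I. Kra, *Riemann Surfaces*
(1992), IV.6: an abelian torsion-free Fuchsian group is cyclic and `ℍ/Λ̄` is then `ℍ`, a punctured disc or an
annulus — none of finite type).  Two bricks, after G. Shimura, *Introduction to the Arithmetic Theory of
Automorphic Functions* §1.3 (centralisers in `SL₂(ℝ)`) and Farkas–Kra IV.5.6 (the cusp coordinate
`e^{2πiτ/x}`):

* §1 `HolRS.exists_psl_mk_translSL_of_commute` — an element of `PSL₂(ℝ)` commuting with a non-trivial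
  translation `T_h` IS a translation `T_x` (the `2 × 2` identity `G T_h = ±T_h G` forces `G = ±T_x`);
  `HolRS.exists_eq_conj_translSL_of_commute` — the same with the cusp at `A • ∞`;
* §2 ★ `HolRS.exists_cuspFunction` — for `A ∈ SL(2, ℝ)` and `x > 0` there is a HOLOMORPHIC `F : ℍ → ℂ` with
  `‖F τ‖ < 1`, `F ((A T_x A⁻¹) • τ) = F τ` and `F` NOT constant (namely `F τ = exp (2πi (A⁻¹ • τ)/x)`);
  `HolRS.forall_mem_zpowers_smul_eq` — invariance under one element gives invariance under its cyclic group.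

Consumed by `…PSLPuncturedGenuineHyperbolic` (a NON-COMPACT finite-type Riemann surface uniformised by `ℍ`
has non-abelian `π₁`).  PROOF-ONLY (no definition, no instance, no named fact); classical; MODEL side of
[AbsTopIII] §2/§4; nothing here bears on the disputed [IUTchIII] Cor. 3.12.

## References
* G. Shimura, *Introduction to the Arithmetic Theory of Automorphic Functions* (1971), §1.3. [Shimura1971]
* H. M. Farkas, I. Kra, *Riemann Surfaces*, 2nd ed. (1992), IV.5.6, IV.6. [FarkasKra1992]
* S. Mochizuki, *Topics in Absolute Anabelian Geometry III* (2015), Cor. 2.4 p.54, Prop. 4.2 (i) p.106.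
  [MochizukiAbsTopIII2015]
-/

set_option autoImplicit false

noncomputable section

open Complex Filter Topology Set Function
open scoped UpperHalfPlane MatrixGroups Matrix Manifold ContDiff Real
open Literature.NumberTheory.Automorphic.Fuchsian (translSL translSL_apply_00 translSL_apply_01
  translSL_apply_10 translSL_apply_11)

namespace Literature.AnabelianGeometry.AbsoluteAnabelian

namespace HolRS

/-! ### §1 The centraliser of a translation in `SL(2, ℝ)` and `PSL₂(ℝ)` -/

/-- Entries of `G T_h`. [folklore] -/
private theorem mul_translSL_entries (G : SL(2, ℝ)) (h : ℝ) :
    (G * translSL h) 0 0 = G 0 0 ∧ (G * translSL h) 0 1 = G 0 0 * h + G 0 1 ∧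
      (G * translSL h) 1 0 = G 1 0 ∧ (G * translSL h) 1 1 = G 1 0 * h + G 1 1 := by
  simp only [Matrix.SpecialLinearGroup.coe_mul, Matrix.mul_apply, Fin.sum_univ_two, translSL_apply_00,
    translSL_apply_01, translSL_apply_10, translSL_apply_11]
  refine ⟨by ring, by ring, by ring, by ring⟩

/-- Entries of `T_h G`. [folklore] -/
private theorem translSL_mul_entries (G : SL(2, ℝ)) (h : ℝ) :
    (translSL h * G) 0 0 = G 0 0 + h * G 1 0 ∧ (translSL h * G) 0 1 = G 0 1 + h * G 1 1 ∧
      (translSL h * G) 1 0 = G 1 0 ∧ (translSL h * G) 1 1 = G 1 1 := by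
  simp only [Matrix.SpecialLinearGroup.coe_mul, Matrix.mul_apply, Fin.sum_univ_two, translSL_apply_00,
    translSL_apply_01, translSL_apply_10, translSL_apply_11]
  refine ⟨by ring, by ring, by ring, by ring⟩

/-- `π(-g) = π(g)` in `PSL₂(ℝ)`. [cite: FarkasKra1992, IV.5.6] -/
theorem psl_mk_neg (g : SL(2, ℝ)) :
    (QuotientGroup.mk' (Subgroup.center SL(2, ℝ)) (-g) : PSL2R) =
      QuotientGroup.mk' (Subgroup.center SL(2, ℝ)) g := by
  rw [← neg_one_mul g, map_mul]
  have : (QuotientGroup.mk' (Subgroup.center SL(2, ℝ)) (-1) : PSL2R) = 1 := by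
    rw [QuotientGroup.mk'_apply, ← QuotientGroup.mk_one, QuotientGroup.eq, mul_one]
    exact (Subgroup.center SL(2, ℝ)).inv_mem (mem_center_sl_iff.mpr (Or.inr rfl))
  rw [this, one_mul]

/-- **An element of `SL(2, ℝ)` commuting with a non-trivial translation is `±` a translation**:
`G T_h = T_h G`, `h ≠ 0` ⇒ `c = 0`, `a = d = ±1`, so `π(G) = π(T_x)` with `x = a b`.
[cite: Shimura1971, §1.3] -/
theorem exists_psl_mk_eq_translSL_of_mul_eq {G : SL(2, ℝ)} {h : ℝ} (hh : h ≠ 0)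
    (hc : G * translSL h = translSL h * G) :
    ∃ x : ℝ, (QuotientGroup.mk' (Subgroup.center SL(2, ℝ)) G : PSL2R) =
      QuotientGroup.mk' (Subgroup.center SL(2, ℝ)) (translSL x) := by
  obtain ⟨h00, h01, -, -⟩ := mul_translSL_entries G h
  obtain ⟨h00', h01', -, -⟩ := translSL_mul_entries G h
  have e00 : (G * translSL h) 0 0 = (translSL h * G) 0 0 := by rw [hc]
  have e01 : (G * translSL h) 0 1 = (translSL h * G) 0 1 := by rw [hc]
  rw [h00, h00'] at e00
  rw [h01, h01'] at e01
  have hc0 : G 1 0 = 0 := by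
    have : h * G 1 0 = 0 := by linarith
    exact (mul_eq_zero.mp this).resolve_left hh
  have had : G 0 0 = G 1 1 := by
    have : (G 0 0 - G 1 1) * h = 0 := by linarith
    exact sub_eq_zero.mp ((mul_eq_zero.mp this).resolve_right hh)
  have hdet : G 0 0 * G 1 1 - G 0 1 * G 1 0 = 1 := by
    have := G.det_coe
    rwa [Matrix.det_fin_two] at this
  rw [hc0, mul_zero, sub_zero, ← had] at hdet
  -- `a² = 1`, so `a = ±1`
  rcases mul_self_eq_one_iff.mp hdet with ha | ha
  · refine ⟨G 0 1, congrArg _ ?_⟩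
    ext i j
    fin_cases i <;> fin_cases j
    · simpa using ha
    · simp
    · simpa using hc0
    · simpa using had.symm.trans ha
  · refine ⟨-(G 0 1), ?_⟩
    rw [← psl_mk_neg G]
    refine congrArg _ ?_
    ext i j
    fin_cases i <;> fin_cases j
    · simp [Matrix.SpecialLinearGroup.coe_neg]; linarith
    · simp [Matrix.SpecialLinearGroup.coe_neg]
    · simpa [Matrix.SpecialLinearGroup.coe_neg] using hc0
    · simp [Matrix.SpecialLinearGroup.coe_neg]; linarith

/-- `T_h G = -(G T_h)` is impossible in `SL(2, ℝ)` (it forces `a = c = d = 0`). [cite: Shimura1971, §1.3] -/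
theorem translSL_mul_ne_neg_mul (G : SL(2, ℝ)) (h : ℝ) : translSL h * G ≠ -(G * translSL h) := by
  intro hc
  obtain ⟨h00, -, h10, h11⟩ := mul_translSL_entries G h
  obtain ⟨h00', -, h10', h11'⟩ := translSL_mul_entries G h
  have e00 : (translSL h * G) 0 0 = -((G * translSL h) 0 0) := by
    rw [hc, Matrix.SpecialLinearGroup.coe_neg]; rfl
  have e10 : (translSL h * G) 1 0 = -((G * translSL h) 1 0) := by
    rw [hc, Matrix.SpecialLinearGroup.coe_neg]; rfl
  have e11 : (translSL h * G) 1 1 = -((G * translSL h) 1 1) := by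
    rw [hc, Matrix.SpecialLinearGroup.coe_neg]; rfl
  rw [h00', h00] at e00
  rw [h10', h10] at e10
  rw [h11', h11] at e11
  have hc0 : G 1 0 = 0 := by linarith
  have ha0 : G 0 0 = 0 := by rw [hc0] at e00; linarith
  have hd0 : G 1 1 = 0 := by rw [hc0] at e11; linarith
  have hdet : G 0 0 * G 1 1 - G 0 1 * G 1 0 = 1 := by
    have := G.det_coe
    rwa [Matrix.det_fin_two] at this
  rw [ha0, hc0, hd0] at hdet
  norm_num at hdet

/-- **The centraliser of a non-trivial translation in `PSL₂(ℝ)` consists of translations**: if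
`q · π(T_h) = π(T_h) · q` with `h ≠ 0`, then `q = π(T_x)` for some `x ∈ ℝ`.  (Lift `q = π(G)`: then
`T_h G = ± G T_h` in `SL(2, ℝ)`; the sign `-` is impossible, the sign `+` gives `G = ±T_x`.)
[cite: Shimura1971, §1.3] [cite: FarkasKra1992, IV.5.6] -/
theorem exists_psl_mk_translSL_of_commute {q : PSL2R} {h : ℝ} (hh : h ≠ 0)
    (hc : q * QuotientGroup.mk' (Subgroup.center SL(2, ℝ)) (translSL h) =
      QuotientGroup.mk' (Subgroup.center SL(2, ℝ)) (translSL h) * q) :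
    ∃ x : ℝ, q = QuotientGroup.mk' (Subgroup.center SL(2, ℝ)) (translSL x) := by
  obtain ⟨G, rfl⟩ := QuotientGroup.mk'_surjective (Subgroup.center SL(2, ℝ)) q
  rw [← map_mul, ← map_mul, QuotientGroup.mk'_apply, QuotientGroup.mk'_apply, QuotientGroup.eq] at hc
  rcases mem_center_sl_iff.mp hc with h1 | h1
  · -- `(G T)⁻¹ (T G) = 1`: they commute
    have hc' : G * translSL h = translSL h * G := by
      rw [inv_mul_eq_one] at h1
      exact h1
    exact exists_psl_mk_eq_translSL_of_mul_eq hh hc'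
  · -- `(G T)⁻¹ (T G) = -1`: impossible
    exfalso
    apply translSL_mul_ne_neg_mul G h
    rw [inv_mul_eq_iff_eq_mul, mul_neg_one] at h1
    exact h1

/-- **The same with the cusp at `A • ∞`**: if `q` commutes with `π(A T_h A⁻¹)`, `h ≠ 0`, then
`q = π(A) π(T_x) π(A)⁻¹` for some `x`. [cite: Shimura1971, §1.3] [cite: FarkasKra1992, IV.5.6] -/
theorem exists_eq_conj_translSL_of_commute {q : PSL2R} {A : SL(2, ℝ)} {h : ℝ} (hh : h ≠ 0)
    (hc : q * QuotientGroup.mk' (Subgroup.center SL(2, ℝ)) (A * translSL h * A⁻¹) =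
      QuotientGroup.mk' (Subgroup.center SL(2, ℝ)) (A * translSL h * A⁻¹) * q) :
    ∃ x : ℝ, q = QuotientGroup.mk' (Subgroup.center SL(2, ℝ)) A *
      QuotientGroup.mk' (Subgroup.center SL(2, ℝ)) (translSL x) *
        (QuotientGroup.mk' (Subgroup.center SL(2, ℝ)) A)⁻¹ := by
  set a : PSL2R := QuotientGroup.mk' (Subgroup.center SL(2, ℝ)) A with ha
  set t : PSL2R := QuotientGroup.mk' (Subgroup.center SL(2, ℝ)) (translSL h) with ht
  rw [map_mul, map_mul, map_inv] at hc
  -- `q' = a⁻¹ q a` commutes with `t`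
  have hc' : (a⁻¹ * q * a) * t = t * (a⁻¹ * q * a) := by
    calc a⁻¹ * q * a * t = a⁻¹ * (q * (a * t * a⁻¹)) * a := by group
      _ = a⁻¹ * ((a * t * a⁻¹) * q) * a := by rw [hc]
      _ = t * (a⁻¹ * q * a) := by group
  obtain ⟨x, hx⟩ := exists_psl_mk_translSL_of_commute hh hc'
  refine ⟨x, ?_⟩
  rw [← hx]
  group

/-! ### §2 The bounded cusp function -/

/-- The translation `T_x` acts by `τ ↦ τ + x`. [cite: FarkasKra1992, IV.5.6] -/
theorem coe_translSL_smul' (x : ℝ) (τ : ℍ) : (((translSL x) • τ : ℍ) : ℂ) = (τ : ℂ) + x := by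
  rw [UpperHalfPlane.coe_specialLinearGroup_apply]
  simp [translSL_apply_00, translSL_apply_01, translSL_apply_10, translSL_apply_11]

/-- ★ **The bounded cusp function.**  For `A ∈ SL(2, ℝ)` and `x > 0`, the function
`F τ = exp (2πi · (A⁻¹ • τ) / x)` on `ℍ` is holomorphic, satisfies `‖F τ‖ < 1`, is invariant under the
parabolic `A T_x A⁻¹` (`F ((A T_x A⁻¹) • τ) = F τ`), and is not constant.  (It is the coordinate of the
punctured-disc quotient of the horoball at the cusp `A • ∞`.) [cite: FarkasKra1992, IV.5.6]
[cite: MochizukiAbsTopIII2015, Definition 4.1 (i) p.101] -/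
theorem exists_cuspFunction (A : SL(2, ℝ)) {x : ℝ} (hx : 0 < x) :
    ∃ F : ℍ → ℂ, MDifferentiable 𝓘(ℂ, ℂ) 𝓘(ℂ, ℂ) F ∧ (∀ τ, ‖F τ‖ < 1) ∧
      (∀ τ : ℍ, F ((A * translSL x * A⁻¹) • τ) = F τ) ∧ ∃ τ₁ τ₂, F τ₁ ≠ F τ₂ := by
  -- the constant `c = 2π/x > 0` and the function
  set c : ℝ := 2 * π / x with hc
  have hc0 : 0 < c := div_pos Real.two_pi_pos hx
  have hcx : (c : ℂ) * (x : ℂ) = 2 * π := by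
    rw [← ofReal_mul, hc, div_mul_cancel₀ _ hx.ne']
    push_cast
    ring
  refine ⟨fun τ => exp ((c : ℂ) * ((A⁻¹ • τ : ℍ) : ℂ) * I), ?_, ?_, ?_, ?_⟩
  · -- holomorphic: Möbius map, then the inclusion `ℍ → ℂ`, then an entire function
    have h1 : MDifferentiable 𝓘(ℂ, ℂ) 𝓘(ℂ, ℂ) (fun τ : ℍ => ((A⁻¹ • τ : ℍ) : ℂ)) :=
      UpperHalfPlane.mdifferentiable_coe.comp ((contMDiff_sl_smul A⁻¹).mdifferentiable (by simp))
    have h2 : MDifferentiable 𝓘(ℂ, ℂ) 𝓘(ℂ, ℂ) (fun w : ℂ => exp ((c : ℂ) * w * I)) :=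
      mdifferentiable_iff_differentiable.mpr
        (((differentiable_const (c : ℂ)).mul differentiable_id).mul (differentiable_const I)).cexp
    exact h2.comp h1
  · -- `‖F τ‖ = exp (-c · Im (A⁻¹ • τ)) < 1`
    intro τ
    rw [norm_exp, mul_I_re, im_ofReal_mul, Real.exp_lt_one_iff, neg_lt_zero]
    exact mul_pos hc0 (A⁻¹ • τ).im_pos
  · -- invariance: `A⁻¹ • ((A T_x A⁻¹) • τ) = T_x • (A⁻¹ • τ) = (A⁻¹ • τ) + x`, and `exp (2πi) = 1`
    intro τ
    have hsm : (A⁻¹ • ((A * translSL x * A⁻¹) • τ) : ℍ) = translSL x • (A⁻¹ • τ) := by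
      rw [← mul_smul, ← mul_assoc, ← mul_assoc, inv_mul_cancel, one_mul, mul_smul]
    beta_reduce
    rw [hsm, coe_translSL_smul', mul_add, add_mul, exp_add, hcx, exp_two_pi_mul_I, mul_one]
  · -- not constant: at `A • i` and `A • 2i` the moduli differ
    refine ⟨A • UpperHalfPlane.mk I (by simp), A • UpperHalfPlane.mk (2 * I) (by simp), fun heq => ?_⟩
    have h := congrArg (fun z : ℂ => ‖z‖) heq
    simp only [inv_smul_smul, norm_exp, mul_I_re, UpperHalfPlane.coe_mk, I_im, mul_im, I_re, re_ofNat,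
      im_ofNat, ofReal_re, ofReal_im, mul_one, mul_zero, zero_mul, add_zero] at h
    have := Real.exp_injective h
    linarith

/-- Invariance of a function on `ℍ` under one Möbius transformation gives invariance under the cyclic
group it generates (automorphy for `⟨γ⟩`). [cite: FarkasKra1992, IV.5.6] -/
theorem forall_mem_zpowers_smul_eq {Γ : Type*} [Group Γ] [MulAction Γ ℍ] {F : ℍ → ℂ} {γ : Γ}
    (hγ : ∀ τ : ℍ, F (γ • τ) = F τ) : ∀ q ∈ Subgroup.zpowers γ, ∀ τ : ℍ, F (q • τ) = F τ := by
  -- the stabiliser of `F` is a subgroup containing `γ`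
  let S : Subgroup Γ :=
    { carrier := {q | ∀ τ : ℍ, F (q • τ) = F τ}
      mul_mem' := fun {a b} ha hb τ => by rw [mul_smul, ha, hb]
      one_mem' := fun τ => by rw [one_smul]
      inv_mem' := fun {a} ha τ => by rw [← ha (a⁻¹ • τ), smul_inv_smul] }
  have hle : Subgroup.zpowers γ ≤ S := (Subgroup.zpowers_le (H := S)).mpr hγ
  exact fun q hq => hle hq

end HolRS

end Literature.AnabelianGeometry.AbsoluteAnabelian

end
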